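import Mathlib
import HarnessLib
import Summits.ResolutionOfSingularities.ResolutionOfSingularities.Theorems.WildQuotientsWildQuotientResolutionTerminalBlowupModel
import Summits.ResolutionOfSingularities.ResolutionOfSingularities.Theorems.WildQuotientsWildQuotientResolutionAffineQuotientData
import Summits.ResolutionOfSingularities.ResolutionOfSingularities.Theorems.WildQuotientsWildQuotientResolutionAffineQuotientEtale
import Summits.ResolutionOfSingularities.ResolutionOfSingularities.Theorems.WildQuotientsWildQuotientResolutionCyclicTransfer
import Literature.AlgebraicGeometry.Resolution.AffineBlowupUniversal
import Literature.AlgebraicGeometry.Resolution.AffineBlowupIntegral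

/-!
# One regular blow-up resolves a wild `ℤ/p`-quotient with invariant-generated augmentation ideal

Crux stmt-ResolutionOfSingularities-15640 (`WildQuotients.WildQuotientResolution`), line `Sketch`,
sector `|G| = p`; CHAIN w45c v4 (the abstract form of rung LSB p471938 and of CRUX-PLAN v4 §R (β)).
[OURS · L1 W4.5c] — NOT a statement of the manuscript.

**`hasResolution_fixedPoints_of_isRegular_affineBlowup`.** Let `k` be a field of characteristic
`p`, `B` a domain of finite type over `k` of positive dimension, `G` a group of order `p` acting on
`B` by `k`-algebra automorphisms, and `I = (c₁,…,cₙ) ≠ 0` an ideal such that for every `g ≠ 1`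
the generators `c_j` are `g`-invariant, `g ≡ id (mod I)` and `c_j ∈ (g b - b : b ∈ B)` (so `I`
is the augmentation ideal of every `g ≠ 1`, generated by invariants). If the blow-up
`Bl_I Spec B` is REGULAR, then `Spec B^G` has a resolution of singularities: the lifted action on
`Bl_I Spec B` is Király–Lütkebohmert terminal (`TerminalBlowup.liftAction_terminal_spec`,
p471334), `Bl_I Spec B → Spec B` is proper birational with `Bl_I Spec B` integral
(`affineBlowup.*`), `Spec B → Spec B^G` is the quotient datum (`AffineQuotient.*`, p466417) and is
étale over `D(c_j)` for a non-zero (invariant) generator (`exists_dense_etale_morphismRestrict`,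
p464339), and the cyclic divisorial transfer (`CyclicTransfer.cyclicDivisorialTransfer_of_card`,
p459590/p460178) concludes.

**`involution_hasResolution_of_isRegular_affineBlowup`** (the `p = 2` corollary, CRUX-PLAN v4
§R (β)): for an involution `σ ≠ 1` of a domain `B` of finite type and positive dimension over a
field of characteristic `2`, the augmentation ideal `I_σ = (σ b - b : b ∈ B)` is generated by
finitely many elements `σ b_j - b_j`, which are `σ`-INVARIANT (`σ(σ b - b) = b - σ b = σ b - b`
in characteristic `2`); hence if `Bl_{I_σ} Spec B` is regular then `Spec B^σ` has a resolution —
EVERY wild involution quotient of a regular affine variety in characteristic `2` is resolved by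
ONE blow-up whenever that blow-up is regular (for linear `σ` it is: rung LSB / SQZ-4).
-/

-- single-problem summit: the doubled namespace component `ResolutionOfSingularities` is forced
set_option linter.dupNamespace false

noncomputable section

open CategoryTheory AlgebraicGeometry TopologicalSpace
open Literature.AlgebraicGeometry.Resolution

namespace Summit.ResolutionOfSingularities.ResolutionOfSingularities.Theorems.WildQuotientResolution.TerminalBlowup

/-- **One regular blow-up resolves the quotient.** `k` of characteristic `p`, `B` a domain of
finite type over `k` with `dim Spec B > 0`, `G` of order `p` acting by `k`-algebra automorphisms,
`I = (c_j) ≠ 0` with, for every `g ≠ 1`: `g • c_j = c_j`, `g • b - b ∈ I`, and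
`c_j ∈ (g • b - b)`. If `Bl_I Spec B` (`affineBlowup I`) is regular then `Spec B^G` has a
resolution of singularities (K–L terminal lifted action p471334 + quotient data p466417 + generic
étaleness p464339 over `D(c_j)`, `c_j ≠ 0` invariant + cyclic divisorial transfer p460178).
[cite: KiralyLutkebohmert2013, Thm 2] [cite: SGA1, Exp. V, §1–2] -/
theorem hasResolution_fixedPoints_of_isRegular_affineBlowup (p : ℕ) (hp : p.Prime)
    (k : Type) [Field k] [CharP k p] (B : Type) [CommRing B] [IsDomain B] [Algebra k B]
    [Algebra.FiniteType k B] (G : Type) [Group G] [Finite G] [MulSemiringAction G B]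
    [SMulCommClass G k B] (hcard : Nat.card G = p)
    (hdim : ¬ topologicalKrullDim (Spec (CommRingCat.of B)) ≤ 0)
    (I : Ideal B) (hI0 : I ≠ ⊥) {n : ℕ} (cB : Fin n → B) (hcI : Ideal.span (Set.range cB) = I)
    (hgen : ∀ g : G, g ≠ 1 →
      (∀ j, g • cB j = cB j) ∧ (∀ b : B, g • b - b ∈ I) ∧
        ∀ j, cB j ∈ Ideal.span (Set.range fun b : B => g • b - b))
    (hVreg : Scheme.IsRegular (affineBlowup I)) :
    Scheme.HasResolution (Spec (.of (FixedPoints.subalgebra k B G))) := by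
  classical
  haveI : Fact p.Prime := ⟨hp⟩
  haveI : IsNoetherianRing B := Algebra.FiniteType.isNoetherianRing k B
  -- `I` is `G`-stable, and the (C)-package form of `hgen`
  have hIstab : ∀ (g : G) (b : B), b ∈ I → g • b ∈ I := by
    intro g b hb
    by_cases hg : g = 1
    · rw [hg, one_smul]
      exact hb
    · have h := (hgen g hg).2.1 b
      rw [← sub_add_cancel (g • b) b]
      exact I.add_mem h hb
  have hgen' : ∀ g : G, (∀ b : B, g • b = b) ∨
      ((∀ j, g • cB j = cB j) ∧ (∀ b : B, g • b - b ∈ I) ∧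
        ∀ j, cB j ∈ Ideal.span (Set.range fun b : B => g • b - b)) := by
    intro g
    by_cases hg : g = 1
    · left
      intro b
      rw [hg, one_smul]
    · right
      exact hgen g hg
  -- a non-zero generator: invariant, and in every augmentation ideal
  obtain ⟨j₀, hj₀⟩ : ∃ j, cB j ≠ 0 := by
    by_contra h
    apply hI0
    rw [← hcI, Ideal.span_eq_bot]
    rintro _ ⟨j, rfl⟩
    by_contra hj
    exact h ⟨j, hj⟩
  have hfix : cB j₀ ∈ FixedPoints.subalgebra k B G := by
    change ∀ g : G, g • cB j₀ = cB j₀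
    intro g
    by_cases hg : g = 1
    · rw [hg, one_smul]
    · exact (hgen g hg).1 j₀
  have ht0 : (⟨cB j₀, hfix⟩ : FixedPoints.subalgebra k B G) ≠ 0 := fun h =>
    hj₀ (congrArg Subtype.val h)
  -- the rings `A = B^G`, the action on `Spec B` and its terminal model `Bl_I Spec B`
  let A : Subalgebra k B := FixedPoints.subalgebra k B G
  obtain ⟨ρ, hρ⟩ := AffineQuotient.exists_specAction B G
  obtain ⟨ρV, hequiv, hcov, hdiv⟩ :=
    TerminalBlowup.liftAction_terminal_spec (k := k) ρ hρ I hIstab cB hcI hgen'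
      (affineBlowup.isBlowup I)
  haveI : IsIntegral (affineBlowup I) := affineBlowup.isIntegral hI0
  have hbir : IsBirational (affineBlowup.π I) := affineBlowup.isBirational hI0
  -- the quotient data
  let fk : Spec (.of A) ⟶ Spec (.of k) := Spec.map (CommRingCat.ofHom (algebraMap k A))
  let q : Spec (.of B) ⟶ Spec (.of A) := Spec.map (CommRingCat.ofHom (algebraMap A B))
  haveI : LocallyOfFiniteType fk := AffineQuotient.locallyOfFiniteType_specMap_fixedPoints k
  haveI : IsFinite q := AffineQuotient.isFinite_specMap_fixedPoints k
  have hsurj : Function.Surjective q.base := AffineQuotient.surjective_specMap_fixedPoints k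
  have hρq : ∀ g : G, (ρ g).hom ≫ q = q := AffineQuotient.specAction_comp k ρ hρ
  have horb : ∀ x y : Spec (CommRingCat.of B), q.base x = q.base y →
      ∃ g : G, (ρ g).hom.base x = y :=
    fun x y hxy => AffineQuotient.exists_specAction_base_eq k ρ hρ x y hxy
  -- generically étale: over `D(c_{j₀})`
  have hU : ∃ U : (Spec (.of A)).Opens, Dense (U : Set (Spec (.of A))) ∧ Etale (q ∣_ U) :=
    AffineQuotient.exists_dense_etale_morphismRestrict k (⟨cB j₀, hfix⟩ : A) ht0
      fun g hg => (hgen g hg).2.2 j₀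
  -- `dim Spec B^G = dim Spec B > 0`
  have hdim' : ¬ topologicalKrullDim (Spec (CommRingCat.of A)) ≤ 0 := by
    rw [AffineQuotient.topologicalKrullDim_spec_fixedPoints k]
    exact hdim
  -- the transfer
  exact CyclicTransfer.cyclicDivisorialTransfer_of_card p hp k (Spec (.of B)) (Spec (.of A)) fk q
    G ρ hcard hdim' hsurj hU hρq horb (affineBlowup I) (affineBlowup.π I) ρV hbir hVreg hequiv
    hcov hdiv

/-- **Finitely many generators of the form `σ b - b` for the augmentation ideal** of an
endomorphism of a Noetherian ring. [folklore] -/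
theorem exists_fin_generators_augIdeal {B : Type} [CommRing B] [IsNoetherianRing B]
    (σ : B →+* B) :
    ∃ (n : ℕ) (b : Fin n → B),
      Ideal.span (Set.range fun j => σ (b j) - b j) =
        Ideal.span (Set.range fun x : B => σ x - x) := by
  classical
  have hfg : (Ideal.span (Set.range fun x : B => σ x - x)).FG := IsNoetherian.noetherian _
  obtain ⟨s, hs, hspan⟩ := (Submodule.fg_span_iff_fg_span_finset_subset _).mp hfg
  -- choose a preimage for every element of `s`
  have hpre : ∀ c : s, ∃ x : B, σ x - x = c := fun c => by
    obtain ⟨x, hx⟩ := hs c.2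
    exact ⟨x, hx⟩
  choose x hx using hpre
  obtain ⟨n, e⟩ : ∃ n, Nonempty (Fin n ≃ s) :=
    ⟨Fintype.card s, ⟨(Fintype.equivFin s).symm⟩⟩
  obtain ⟨e⟩ := e
  refine ⟨n, fun j => x (e j), ?_⟩
  have hrange : Set.range (fun j => σ (x (e j)) - x (e j)) = (↑s : Set B) := by
    ext c
    constructor
    · rintro ⟨j, rfl⟩
      dsimp only
      rw [hx]
      exact (e j).2
    · intro hc
      refine ⟨e.symm ⟨c, hc⟩, ?_⟩
      dsimp only
      rw [hx, Equiv.apply_symm_apply]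
  rw [hrange]
  exact hspan.symm

/-- **CRUX-PLAN v4 §R (β): a wild involution quotient in characteristic `2` is resolved by one
blow-up whenever that blow-up is regular.** `k` of characteristic `2`, `B` a domain of finite
type over `k` with `dim Spec B > 0`, `σ ≠ 1` a `k`-algebra involution of `B`,
`I_σ = (σ b - b : b ∈ B)`. If `Bl_{I_σ} Spec B` is regular then `Spec B^{⟨σ⟩}` has a resolution
of singularities. (The generators `σ b - b` of `I_σ` are `σ`-invariant because `-1 = 1`, and
`⟨σ⟩ = {1, σ}`, so `hasResolution_fixedPoints_of_isRegular_affineBlowup` applies.)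
[OURS · L1 W4.5c] [cite: KiralyLutkebohmert2013, Thm 2] -/
theorem involution_hasResolution_of_isRegular_affineBlowup (k : Type) [Field k] [CharP k 2]
    (B : Type) [CommRing B] [IsDomain B] [Algebra k B] [Algebra.FiniteType k B]
    (σ : B ≃ₐ[k] B) (hσ1 : σ ≠ 1) (hσ2 : σ * σ = 1)
    (hdim : ¬ topologicalKrullDim (Spec (CommRingCat.of B)) ≤ 0)
    (hVreg : Scheme.IsRegular (affineBlowup (Ideal.span (Set.range fun b : B => σ b - b)))) :
    Scheme.HasResolution
      (Spec (.of (FixedPoints.subalgebra k B (Subgroup.zpowers σ)))) := by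
  classical
  haveI : IsNoetherianRing B := Algebra.FiniteType.isNoetherianRing k B
  -- characteristic `2` in `B`
  haveI : CharP B 2 := charP_of_injective_algebraMap (algebraMap k B).injective 2
  -- the group `⟨σ⟩` has order `2` and every `g ≠ 1` in it is `σ`
  have hσ2' : σ ^ 2 = 1 := by rw [pow_two, hσ2]
  have hord : orderOf σ = 2 := orderOf_eq_prime hσ2' hσ1
  have hcard : Nat.card (Subgroup.zpowers σ) = 2 := by rw [Nat.card_zpowers, hord]
  haveI : Finite (Subgroup.zpowers σ) := Nat.finite_of_card_ne_zero (by rw [hcard]; decide)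
  have hgσ : ∀ g : Subgroup.zpowers σ, g ≠ 1 → (g : B ≃ₐ[k] B) = σ := by
    intro g hg
    have hfin : IsOfFinOrder σ := isOfFinOrder_iff_pow_eq_one.mpr ⟨2, two_pos, hσ2'⟩
    obtain ⟨m, hm⟩ : (g : B ≃ₐ[k] B) ∈ Submonoid.powers σ :=
      hfin.mem_powers_iff_mem_zpowers.mpr g.2
    have hm' : σ ^ m = (g : B ≃ₐ[k] B) := hm
    rcases Nat.mod_two_eq_zero_or_one m with h | h
    · exfalso
      apply hg
      apply Subtype.ext
      change (g : B ≃ₐ[k] B) = 1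
      rw [← hm', ← pow_mod_orderOf, hord, h, pow_zero]
    · rw [← hm', ← pow_mod_orderOf, hord, h, pow_one]
  -- the augmentation ideal `I_σ`, non-zero, with invariant generators `σ b_j - b_j`
  set I : Ideal B := Ideal.span (Set.range fun b : B => σ b - b) with hI
  have hI0 : I ≠ ⊥ := by
    intro h
    apply hσ1
    ext b
    have hb : σ b - b ∈ I := Ideal.subset_span ⟨b, rfl⟩
    rw [h, Ideal.mem_bot, sub_eq_zero] at hb
    rw [hb, AlgEquiv.one_apply]
  obtain ⟨n, b, hcI⟩ := exists_fin_generators_augIdeal (σ : B →+* B)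
  have hcI' : Ideal.span (Set.range fun j => σ (b j) - b j) = I := hcI
  have hinv : ∀ x : B, σ (σ x - x) = σ x - x := by
    intro x
    have hx : σ (σ x) = x := by
      rw [← AlgEquiv.mul_apply, hσ2, AlgEquiv.one_apply]
    rw [map_sub, hx]
    have h2 : (2 : B) = 0 := CharP.cast_eq_zero B 2
    linear_combination (x - σ x) * h2
  refine hasResolution_fixedPoints_of_isRegular_affineBlowup 2 Nat.prime_two k B
    (Subgroup.zpowers σ) hcard hdim I hI0 (fun j => σ (b j) - b j) hcI' ?_ hVreg
  intro g hg
  have hsmul : ∀ x : B, g • x = σ x := fun x => by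
    change (g : B ≃ₐ[k] B) x = σ x
    rw [hgσ g hg]
  refine ⟨fun j => ?_, fun x => ?_, fun j => ?_⟩
  · rw [hsmul, hinv]
  · rw [hsmul]
    exact Ideal.subset_span ⟨x, rfl⟩
  · have hfun : (fun x : B => g • x - x) = fun x : B => σ x - x := funext fun x => by rw [hsmul]
    rw [hfun]
    exact Ideal.subset_span ⟨b j, rfl⟩

end Summit.ResolutionOfSingularities.ResolutionOfSingularities.Theorems.WildQuotientResolution.TerminalBlowup

end
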